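import Summits.QuantumFields.BalabanUV.Beta.D1BFx.ChartDefectRowLamfMass
import Summits.QuantumFields.BalabanUV.Beta.D1BFx.PackedStraightColumnLambdaMass
import Summits.QuantumFields.BalabanUV.Beta.D1BFx.SymHessTableMass
import Summits.QuantumFields.BalabanUV.Beta.D1BFx.PackedColumnJetMass

/-!
# `BalabanUV.Beta.D1BFx.ChartDefectRowLamfClosed` — road «BF-x», binder row D1, PART 24-hyb HEAD (`ChartDefectHead` v1.1's rows): **ROW (lamf) PRICED DOWN TO THE LEG LETTER**
# (leaf-03 g34, TT32; closes TT31 `ChartDefectRowLamfMass`'s only vertex binder at the record): the Λ-PACK `S_Λ = SLam n (lamCoeffOf (KInv n) n) (symHessFFAt ρ_c n)` HAS a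
# hypothesis-free `u`-centred σ-weighted mass letter — gan24-leaf-05 g63's «H-TABLE-MASS» PART B `SymHessTableMass.summable_ ∕ tsum_wfibreMass_blk_symHessFFAt(_le)` (the Hessian
# table's block masses `≤ 2·ell(4,n)²·e^{σ·16n}` on the `tt` block, `0` elsewhere — PART A's pair count, NO lattice volume) fed to g61's «K0-LAM-PACK»
# `PackedStraightColumnLambdaMass.mass_blk_SLam_KInv_le` (the one-shot multiplier-response coefficients pay `(n⁵)⁻¹`, `σ ≤ κ′∕(16n)`) and re-assembled from blocks by TT27a
# `DiagBracketWordMass.wmass_le_of_blk` — so TT31 `decay510_row_lamf_mass_of_env` yields the HEAD's `hAlamf ∕ hBlamf` (and thm 2's `hDlamf`) MODULO `Bdd G₀ S` ONLY, constant CLOSED: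
# `C_lamf(n) = (|cΛ|∕2)·(S·(2·GΛ(n)·MV(n) + 2·GΛ(n)·MV(n)))`, `MV(n) = (4·C_{G₀}′·(1+16∕κ′)⁴)·mT_Λ(n)`, `mT_Λ(n) = ((n⁵)⁻¹·KΛ·(2·ell(4,n)²·e^{σ·4(4n)}))·e^{κ′∕2}`, rate `n·σ`.
LOCATED COUNT (zero weight on rulings): `GΛ = O(1)` (TT31), `mT_Λ ≍ n⁻⁵·(10n)² = n⁻³`, so `C_lamf ≍ |cΛ|·S·n⁻³`; with g63 «G0-BDD» `S = (1+16n)²·S₀` this reads `≍ |cΛ|·S₀·n⁻¹` at the `n`-free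
rate `n·σ = κ′∕16` (`σ := κ′∕(16n)`) — the (lamf) row DECAYS along `n = Lc^m` as far as the one-step resolvent's sup letter `S₀` is `n`-uniform (not claimed here).

HONEST DEPENDENCY (cell records, verbatim): «continuum YM on T⁴ ⇐ BetaPertH ∧ nine spine estimates (0/9 proved); BetaPertH ⇐ (D1) ∧ (D4) ∧
CAP+tail; G-an2-4 gates asym, D1 and NE2/3/4.»  HONEST FRAMING (cell contract, verbatim): «discharging `BetaPertH` makes Bałaban's UV stability
UNCONDITIONAL — a real constructive-QFT result; it is NOT the continuum limit and NOT the Clay problem.»  THIS MODULE is [folklore] `ℓ¹` ∕ (1.22) read-out bookkeeping BY NAME over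
landed objects; ONE displayed row of the HEAD priced MODULO the displayed leg letter `Bdd G₀ S` (its `n`-law NOT claimed) — per-word INTERMEDIATE (an2 R-D1-g45-4 (3)), not the HEAD, not
the END; no definition, no `def … : Prop`, nothing cited, 0 sorry.  0∕4 row-D1 binders (hW ∕ hR ∕ D1Tel ∕ D1Rep); (J1) ONE OPEN ROW (eight displayed rows); (K) NOT closed; NOT D1,
NEVER «G-an2-4 closed», NOT `BetaPertH`, NOT continuum, NOT Clay.

ABSOLUTE RULE (cell charter, verbatim): «No internally-minted statement may enter as a cited fact. Every hypothesis is either kernel-proved in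
this package or a verbatim quotation of a PUBLISHED theorem with page reference. The manuscript(s) under audit are NOT citable for their own
disputed steps — they are the thing under adjudication; programme-internal (2001/route/tribunal) claims are never citable.»

Unit `b2b-balaban-beta-d1-formalise-leaf-03` (gen 34), D1 formalisation swarm LEAF PROVER 03, road «BF-x»; 2026-08-24.  No existing file touched.
-/

noncomputable section

namespace Summit.QuantumFields.BalabanUV.Beta.D1BFx.ChartDefectRowLamfClosed

open Finset
open scoped BigOperators
open Literature.MathematicalPhysics.QuantumFieldTheory
open Literature.MathematicalPhysics.QuantumFieldTheory.Balaban1983to89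
open Literature.MathematicalPhysics.QuantumFieldTheory.Balaban1983to89.Beta
open B12Sec2to5 (l1 l1_nonneg Decay510)
open DecimatedMomentSummable (AbsMoment₂)
open B5Hk163Strip (kappa163 kappa163_pos)
open B5Hk163Decay (MG163)
open B5Hk163TorusHolderDecay (MD163)
open B4TorusKernel (periodConst)
open ExpKernelCalculus (Site MKer Zl comp tadpole)
open AveragingHessianKernels (ell)
open AffineAveraging (box toSite)
open AveragingContours (blk)
open AveragingContoursRooted (ctr ctrOff ctrOff_mem_box)
open KernelWard (Bdd)
open OneStepResolventKernel (Fib KInv)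
open OneStepKernelFamily (colH KInvStep vertexOfK)
open InterLevelTransport (SLam)
open StepJetData (wilsonA)
open BalabanStepJets (lamCoeffOf)
open Summit.QuantumFields.BalabanUV.Beta.BorderedHessian (diagK)
open Summit.QuantumFields.BalabanUV.Beta.AxialDressingRooted (coDressKBmAt)
open Summit.QuantumFields.BalabanUV.Beta.AveragingWardRootedStencils (legSite)
open Summit.QuantumFields.BalabanUV.Beta.CompositeCorrectorLocality (blockSitesF)
open Summit.QuantumFields.BalabanUV.Beta.SymAveragingHessianCounts (symVhSAt symHessFFAt)
open Summit.QuantumFields.BalabanUV.Beta.SymSecondOrderTablesAn1 (symTablesAn1S2)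
open Summit.QuantumFields.BalabanUV.Beta.CombChartStepJets (JsB12CombSh0)
open Summit.QuantumFields.BalabanUV.Beta.SymCorrectorFace (faceWt)
open Summit.QuantumFields.BalabanUV.Beta.D1BFx.DiagBracketWordMass (wmass_le_of_blk)
open Summit.QuantumFields.BalabanUV.Beta.D1BFx.PackedStraightColumnLambdaMass (mass_blk_SLam_KInv_le)
open Summit.QuantumFields.BalabanUV.Beta.D1BFx.SymHessTableMass (summable_wfibreMass_blk_symHessFFAt tsum_wfibreMass_blk_symHessFFAt_le)
open Summit.QuantumFields.BalabanUV.Beta.ChartConjugationReflection (vertexOfK_eq_sum)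
open Summit.QuantumFields.BalabanUV.Beta.D1BFx.PackedColumnJetMass (mass_sum_wsum_colH_G₀_le)
open Summit.QuantumFields.BalabanUV.Beta.D1BFx.ChartDefectRowLamfMass (abs_faceLamGen_G₀_legSite_le faceLamGenConst_nonneg decay510_row_lamf_mass_of_env)
open DecimatedMomentSummable (absMoment₂_of_decay510)
open B12Sec2to5 (secondMoment_abs_le_of_decay510)

variable {d : ℕ}

section Record

variable (n : ℕ) [NeZero n]

/-! ## §0 The σ-weighted mass of a `G₀`-packed first jet from its pack's own mass — gan24-leaf-05 g53∕g60's «G0-JET-MASS» (power `n⁰`) -/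

/-- [folklore] **THE σ-WEIGHTED MASS OF A `G₀`-PACKED FIRST JET FROM ITS PACK's OWN MASS** (`1 ≤ n`, `0 ≤ σ ≤ κ′∕(16n)`; g60 FILE B `PackedColumnJetMass.mass_sum_wsum_colH_G₀_le` at the
road root `ctr 4 n = toSite (ctrOff 4 n)`, re-indexed to `[NeZero n]` and to the fibre-sum-outside shape of TT27a's `hVA ∕ hVE` socket; an2 `vertexOfK_eq_sum`): if every member `T κ u` of a
first-jet pack has `u`-centred σ-weighted mass `≤ mT`, then for every `(ν, y′)` the packed jet `vertexOfK G₀ n T ν y′` has σ-weighted mass about `n•y′`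
`≤ (4·C_{G₀}′·(1 + 16∕κ′)⁴)·mT`, `C_{G₀}′ = C₄·(1 + 8(1 + e^{κ′}))·e^{κ′}` — NO power of `n`.  (TT31's `hV` binder BY TERM.) -/
theorem wmass_vertexOfK_G₀_of_packMass (hn : 1 ≤ n) {T : Fin (3 + 1) → (Fin (3 + 1) → ℤ) → MKer 4 (Fib 3)} {σ mT : ℝ} (hσ0 : 0 ≤ σ)
    (hσ16 : σ ≤ kappa163 4 / 4 / (16 * ((n : ℕ) : ℝ)))
    (hTs : ∀ (κ : Fin (3 + 1)) (u : Site 4), Summable fun p : Site 4 × Site 4 =>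
      ∑ a : Fib 3, ∑ b : Fib 3, |T κ u p.1 p.2 a b| * Real.exp (σ * (l1 (p.1 - u) + l1 (p.2 - u))))
    (hTm : ∀ (κ : Fin (3 + 1)) (u : Site 4), ∑' p : Site 4 × Site 4,
      ∑ a : Fib 3, ∑ b : Fib 3, |T κ u p.1 p.2 a b| * Real.exp (σ * (l1 (p.1 - u) + l1 (p.2 - u))) ≤ mT)
    (ν : Fin (3 + 1)) (y' : Site 4) :
    (Summable fun pr : Site 4 × Site 4 =>
        (∑ a : Fib 3, ∑ b : Fib 3, |vertexOfK (coDressKBmAt (ctr 4 n) n (KInvStep (d := 3) n 0)) n T ν y' pr.1 pr.2 a b|)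
          * Real.exp (σ * (l1 (pr.1 - (n : ℤ) • y') + l1 (pr.2 - (n : ℤ) • y')))) ∧
      ∑' pr : Site 4 × Site 4,
          (∑ a : Fib 3, ∑ b : Fib 3, |vertexOfK (coDressKBmAt (ctr 4 n) n (KInvStep (d := 3) n 0)) n T ν y' pr.1 pr.2 a b|)
            * Real.exp (σ * (l1 (pr.1 - (n : ℤ) • y') + l1 (pr.2 - (n : ℤ) • y')))
        ≤ (4 * ((MG163 4 * periodConst (kappa163 4) 3) * (1 + 8 * (1 + Real.exp (kappa163 4 / 4))) * Real.exp (kappa163 4 / 4))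
            * (1 + 16 / (kappa163 4 / 4)) ^ 4) * mT := by
  obtain ⟨m, rfl⟩ : ∃ m, n = m + 1 := ⟨n - 1, (Nat.succ_pred_eq_of_pos (Nat.pos_of_ne_zero (NeZero.ne n))).symm⟩
  have h := mass_sum_wsum_colH_G₀_le m (ctrOff_mem_box hn) hσ0 hσ16 hTs hTm ν y'
  rw [← vertexOfK_eq_sum] at h
  simp only [Finset.sum_mul]
  exact h

/-! ## §1 The Λ-pack's own `u`-centred weighted mass at the record — hypothesis-free -/

/-- [our objects + folklore] **THE Λ-PACK's `u`-CENTRED σ-WEIGHTED MASS, HYPOTHESIS-FREE** (`0 ≤ σ ≤ κ′∕(16n)`): every member `S_Λ κ u` of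
`S_Λ = SLam n (lamCoeffOf (KInv n) n) (symHessFFAt ρ_c n)` has summable `u`-centred σ-weighted fibre mass `≤ mT_Λ(n) := ((n⁵)⁻¹·KΛ·(2·ell(4,n)²·e^{σ·4(4n)}))·e^{κ′∕2}`
(`KΛ = 4·(3⁴·4·64·C₄·e^{κ′}e^{κ′}e^{κ′})·e^{κ′∕2}·Zl 4 (κ′∕8)`) — g63 PART B's table block masses (`tt`: `2·ell²·e^{σ·16n}`; `tf ∕ ft ∕ ff`: `0`) through g61 `mass_blk_SLam_KInv_le`,
the four blocks re-assembled by TT27a `wmass_le_of_blk`; §0's `hTs ∕ hTm` BY TERM (fibre sum inside).  Located `≍ n⁻³`. -/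
theorem packMass_SLam_record {σ : ℝ} (hσ0 : 0 ≤ σ) (hσ16 : σ ≤ kappa163 4 / 4 / (16 * ((n : ℕ) : ℝ))) (κ : Fin (3 + 1)) (u : Site 4) :
    (Summable fun p : Site 4 × Site 4 =>
        ∑ a : Fib 3, ∑ b : Fib 3, |(SLam n (lamCoeffOf (KInv (N := n)) n) (symHessFFAt (ctr 4 n) n)) κ u p.1 p.2 a b| * Real.exp (σ * (l1 (p.1 - u) + l1 (p.2 - u)))) ∧
      ∑' p : Site 4 × Site 4,
          ∑ a : Fib 3, ∑ b : Fib 3, |(SLam n (lamCoeffOf (KInv (N := n)) n) (symHessFFAt (ctr 4 n) n)) κ u p.1 p.2 a b| * Real.exp (σ * (l1 (p.1 - u) + l1 (p.2 - u)))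
        ≤ ((((n : ℝ) ^ 5)⁻¹ * (4 * ((3 : ℝ) ^ (3 + 1) * ((3 + 1 : ℕ) : ℝ) * (16 * ((3 + 1 : ℕ) : ℝ)) * (MG163 4 * periodConst (kappa163 4) 3)
              * Real.exp (kappa163 4 / 4) * Real.exp (kappa163 4 / 4) * Real.exp (kappa163 4 / 4))
            * Real.exp (kappa163 4 / 4 / 2) * Zl 4 (kappa163 4 / 4 / 8)) * (2 * (ell (3 + 1) n : ℝ) ^ 2 * Real.exp (σ * (4 * ((((3 : ℕ) : ℝ) + 1) * (n : ℝ)))))) * Real.exp (kappa163 4 / 4 / 2)) := by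
  have hn1 : 1 ≤ n := Nat.one_le_iff_ne_zero.2 (NeZero.ne n)
  -- g63 PART B: the Hessian table's block masses at the road root (`ctr 4 n = toSite (ctrOff 4 n)`)
  have hHs : ∀ (μ : Fin (3 + 1)) (w : Fin (3 + 1) → ℤ) (j k : Bool), Summable fun p : Site 4 × Site 4 =>
      ∑ g : Fin (3 + 1), ∑ f : Fin (3 + 1), |PackedKernelSplit.blk (symHessFFAt (ctr 4 n) n μ w) j k p.1 p.2 g f| * Real.exp (σ * (l1 (p.1 - (n : ℤ) • w) + l1 (p.2 - (n : ℤ) • w))) :=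
    fun μ w j k => summable_wfibreMass_blk_symHessFFAt (d := 3) (L := n) (ctrOff_mem_box hn1) σ μ w j k
  have hHm : ∀ (μ : Fin (3 + 1)) (w : Fin (3 + 1) → ℤ) (j k : Bool), ∑' p : Site 4 × Site 4,
      ∑ g : Fin (3 + 1), ∑ f : Fin (3 + 1), |PackedKernelSplit.blk (symHessFFAt (ctr 4 n) n μ w) j k p.1 p.2 g f| * Real.exp (σ * (l1 (p.1 - (n : ℤ) • w) + l1 (p.2 - (n : ℤ) • w)))
        ≤ (if j = true ∧ k = true then 2 * (ell (3 + 1) n : ℝ) ^ 2 * Real.exp (σ * (4 * ((((3 : ℕ) : ℝ) + 1) * (n : ℝ)))) else 0) :=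
    fun μ w j k => tsum_wfibreMass_blk_symHessFFAt_le (d := 3) (L := n) hn1 (ctrOff_mem_box hn1) hσ0 μ w j k
  -- g61: the Λ-pack's block masses; TT27a: the four blocks give the full mass (fibre sum outside)
  have hblk := fun j k => mass_blk_SLam_KInv_le n hσ0 hσ16 hHs hHm κ u j k
  have h := wmass_le_of_blk (W := (SLam n (lamCoeffOf (KInv (N := n)) n) (symHessFFAt (ctr 4 n) n)) κ u) (fun q : Site 4 × Site 4 => Real.exp (σ * (l1 (q.1 - u) + l1 (q.2 - u))))
    (B := fun j k : Bool => (((n : ℝ) ^ 5)⁻¹ * (4 * ((3 : ℝ) ^ (3 + 1) * ((3 + 1 : ℕ) : ℝ) * (16 * ((3 + 1 : ℕ) : ℝ)) * (MG163 4 * periodConst (kappa163 4) 3)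
              * Real.exp (kappa163 4 / 4) * Real.exp (kappa163 4 / 4) * Real.exp (kappa163 4 / 4))
            * Real.exp (kappa163 4 / 4 / 2) * Zl 4 (kappa163 4 / 4 / 8))
        * (if j = true ∧ k = true then 2 * (ell (3 + 1) n : ℝ) ^ 2 * Real.exp (σ * (4 * ((((3 : ℕ) : ℝ) + 1) * (n : ℝ)))) else 0)) * Real.exp (kappa163 4 / 4 / 2))
    (fun j i => hblk j i)
  -- fibre sum inside
  have e : (fun p : Site 4 × Site 4 => ∑ a : Fib 3, ∑ b : Fib 3, |(SLam n (lamCoeffOf (KInv (N := n)) n) (symHessFFAt (ctr 4 n) n)) κ u p.1 p.2 a b| * Real.exp (σ * (l1 (p.1 - u) + l1 (p.2 - u))))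
      = fun p => (∑ a : Fib 3, ∑ b : Fib 3, |(SLam n (lamCoeffOf (KInv (N := n)) n) (symHessFFAt (ctr 4 n) n)) κ u p.1 p.2 a b|) * Real.exp (σ * (l1 (p.1 - u) + l1 (p.2 - u))) := by
    funext p; simp only [Finset.sum_mul]
  rw [e]
  refine ⟨h.1, h.2.trans (le_of_eq ?_)⟩
  simp

/-- [folklore] The record mass constant `mT_Λ(n)` is non-negative. -/
theorem packMassConst_nonneg {σ : ℝ} (hσ0 : 0 ≤ σ) (hσ16 : σ ≤ kappa163 4 / 4 / (16 * ((n : ℕ) : ℝ))) :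
    0 ≤ ((((n : ℝ) ^ 5)⁻¹ * (4 * ((3 : ℝ) ^ (3 + 1) * ((3 + 1 : ℕ) : ℝ) * (16 * ((3 + 1 : ℕ) : ℝ)) * (MG163 4 * periodConst (kappa163 4) 3)
              * Real.exp (kappa163 4 / 4) * Real.exp (kappa163 4 / 4) * Real.exp (kappa163 4 / 4))
            * Real.exp (kappa163 4 / 4 / 2) * Zl 4 (kappa163 4 / 4 / 8)) * (2 * (ell (3 + 1) n : ℝ) ^ 2 * Real.exp (σ * (4 * ((((3 : ℕ) : ℝ) + 1) * (n : ℝ)))))) * Real.exp (kappa163 4 / 4 / 2)) :=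
  le_trans (tsum_nonneg fun p => Finset.sum_nonneg fun a _ => Finset.sum_nonneg fun b _ => by positivity) (packMass_SLam_record n hσ0 hσ16 0 0).2

/-- [our objects + folklore] **THE Λ-VERTEX FAMILY's σ-WEIGHTED MASS AT THE HEAD's LEG, HYPOTHESIS-FREE** (`0 ≤ σ ≤ κ′∕(16n)`): for every `(ν, y′)`,
`V_Λ ν y′ = vertexOfK G₀ n S_Λ ν y′` has summable σ-weighted mass about `n•y′` `≤ MV(n) := (4·C_{G₀}′·(1+16∕κ′)⁴)·mT_Λ(n)` — §0 at §1; TT31's `hV` binder BY TERM.  Located `≍ n⁻³`. -/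
theorem wmass_VLam_record {σ : ℝ} (hσ0 : 0 ≤ σ) (hσ16 : σ ≤ kappa163 4 / 4 / (16 * ((n : ℕ) : ℝ))) (ν : Fin (3 + 1)) (y' : Site 4) :
    (Summable fun pr : Site 4 × Site 4 =>
        (∑ a : Fib 3, ∑ b : Fib 3, |(vertexOfK (coDressKBmAt (ctr 4 n) n (KInvStep (d := 3) n 0)) n (SLam n (lamCoeffOf (KInv (N := n)) n) (symHessFFAt (ctr 4 n) n)) ν y') pr.1 pr.2 a b|)
          * Real.exp (σ * (l1 (pr.1 - (n : ℤ) • y') + l1 (pr.2 - (n : ℤ) • y')))) ∧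
      ∑' pr : Site 4 × Site 4,
          (∑ a : Fib 3, ∑ b : Fib 3, |(vertexOfK (coDressKBmAt (ctr 4 n) n (KInvStep (d := 3) n 0)) n (SLam n (lamCoeffOf (KInv (N := n)) n) (symHessFFAt (ctr 4 n) n)) ν y') pr.1 pr.2 a b|)
            * Real.exp (σ * (l1 (pr.1 - (n : ℤ) • y') + l1 (pr.2 - (n : ℤ) • y'))) ≤ (4 * ((MG163 4 * periodConst (kappa163 4) 3) * (1 + 8 * (1 + Real.exp (kappa163 4 / 4))) * Real.exp (kappa163 4 / 4))
            * (1 + 16 / (kappa163 4 / 4)) ^ 4) * ((((n : ℝ) ^ 5)⁻¹ * (4 * ((3 : ℝ) ^ (3 + 1) * ((3 + 1 : ℕ) : ℝ) * (16 * ((3 + 1 : ℕ) : ℝ)) * (MG163 4 * periodConst (kappa163 4) 3)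
              * Real.exp (kappa163 4 / 4) * Real.exp (kappa163 4 / 4) * Real.exp (kappa163 4 / 4))
            * Real.exp (kappa163 4 / 4 / 2) * Zl 4 (kappa163 4 / 4 / 8)) * (2 * (ell (3 + 1) n : ℝ) ^ 2 * Real.exp (σ * (4 * ((((3 : ℕ) : ℝ) + 1) * (n : ℝ)))))) * Real.exp (kappa163 4 / 4 / 2)) :=
  wmass_vertexOfK_G₀_of_packMass n (Nat.one_le_iff_ne_zero.2 (NeZero.ne n)) hσ0 hσ16
    (fun κ u => (packMass_SLam_record n hσ0 hσ16 κ u).1) (fun κ u => (packMass_SLam_record n hσ0 hσ16 κ u).2) ν y'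

/-! ## §2 Row (lamf) at the HEAD's literal, modulo the leg letter only -/

/-- **ROW (lamf) IN (5.10)-DECAY CURRENCY, ANY GENERATOR ENVELOPE, MODULO `Bdd G₀ S` ONLY** [our objects + folklore] (`n` odd, `n ≥ 1`; envelope BINDER
`hg : |Λf-symbol| ≤ GT·e^{−r_G|x − n•y|₁}`, `0 ≤ GT`; `0 < σ ≤ κ′∕(16n)`): `Decay510 (z ↦ ½·tadpole G₀ (W^{Λ}_f a 0 e z)) ((|cΛ|∕2)·(S·(2·GT·MV(n) + 2·GT·MV(n)))) (n·σ)` — TT31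
`decay510_row_lamf_mass_of_env` at `wmass_VLam_record` (`κ′∕(16n) ≤ κ′∕(4n)`).  The all-blockings form the scale-uniform count uses (`GT := GΛ(n)` for `n ≥ 3`, `GΛ₁(1)` at `n = 1`). -/
theorem decay510_row_lamf_record_of_env (hodd : Odd n) {GT : ℝ} (hGT0 : 0 ≤ GT)
    (hg : ∀ (μ : Fin (3 + 1)) (y x : Site 4) (b : Fib 3),
      |-(∑ α : Fin (3 + 1), ∑ x' ∈ blockSitesF n (blk n (legSite (ctr 4 n) x b)), colH (coDressKBmAt (ctr 4 n) n (KInvStep (d := 3) n 0)) n μ y α x' * (((n : ℝ) ^ 4 / 2) * faceWt (ctrOff 4 n) n α x'))|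
        ≤ GT * Real.exp (-(kappa163 4 / 4 / (4 * ((n : ℕ) : ℝ))) * l1 (x - (n : ℤ) • y)))
    (N : ℕ) (cΛ : ℝ) {S : ℝ} (hG : Bdd (coDressKBmAt (ctr 4 n) n (KInvStep (d := 3) n 0)) S) (hS : 0 ≤ S)
    {σ : ℝ} (hσ : 0 < σ) (hσ16 : σ ≤ kappa163 4 / 4 / (16 * ((n : ℕ) : ℝ))) (a e : Fin (3 + 1)) :
    Decay510 (fun z : Site 4 => (1 / 2 : ℝ) * tadpole (coDressKBmAt (ctr 4 n) n (KInvStep (d := 3) n 0))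
        (((comp (diagK fun x b => -(∑ α : Fin (3 + 1), ∑ x' ∈ blockSitesF n (blk n (legSite (ctr 4 n) x b)), colH (coDressKBmAt (ctr 4 n) n (KInvStep (d := 3) n 0)) n e z α x' * (((n : ℝ) ^ 4 / 2) * faceWt (ctrOff 4 n) n α x'))) (vertexOfK (coDressKBmAt (ctr 4 n) n (KInvStep (d := 3) n 0)) n (fun κ u => ((n : ℝ) ^ 4) • wilsonA 3 κ u + (-((n : ℝ) ^ 8 / 2)) • symVhSAt (ctr 4 n) 3 n rfl κ u) a 0) - comp (vertexOfK (coDressKBmAt (ctr 4 n) n (KInvStep (d := 3) n 0)) n (fun κ u => ((n : ℝ) ^ 4) • wilsonA 3 κ u + (-((n : ℝ) ^ 8 / 2)) • symVhSAt (ctr 4 n) 3 n rfl κ u) a 0) (diagK fun x b => -(∑ α : Fin (3 + 1), ∑ x' ∈ blockSitesF n (blk n (legSite (ctr 4 n) x b)), colH (coDressKBmAt (ctr 4 n) n (KInvStep (d := 3) n 0)) n e z α x' * (((n : ℝ) ^ 4 / 2) * faceWt (ctrOff 4 n) n α x'))))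
              + (comp (diagK fun x b => -(∑ α : Fin (3 + 1), ∑ x' ∈ blockSitesF n (blk n (legSite (ctr 4 n) x b)), colH (coDressKBmAt (ctr 4 n) n (KInvStep (d := 3) n 0)) n a 0 α x' * (((n : ℝ) ^ 4 / 2) * faceWt (ctrOff 4 n) n α x'))) (vertexOfK (coDressKBmAt (ctr 4 n) n (KInvStep (d := 3) n 0)) n (fun κ u => ((n : ℝ) ^ 4) • wilsonA 3 κ u + (-((n : ℝ) ^ 8 / 2)) • symVhSAt (ctr 4 n) 3 n rfl κ u) e z) - comp (vertexOfK (coDressKBmAt (ctr 4 n) n (KInvStep (d := 3) n 0)) n (fun κ u => ((n : ℝ) ^ 4) • wilsonA 3 κ u + (-((n : ℝ) ^ 8 / 2)) • symVhSAt (ctr 4 n) 3 n rfl κ u) e z) (diagK fun x b => -(∑ α : Fin (3 + 1), ∑ x' ∈ blockSitesF n (blk n (legSite (ctr 4 n) x b)), colH (coDressKBmAt (ctr 4 n) n (KInvStep (d := 3) n 0)) n a 0 α x' * (((n : ℝ) ^ 4 / 2) * faceWt (ctrOff 4 n) n α x')))))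
            - ((comp (diagK fun x b => -(∑ α : Fin (3 + 1), ∑ x' ∈ blockSitesF n (blk n (legSite (ctr 4 n) x b)), colH (coDressKBmAt (ctr 4 n) n (KInvStep (d := 3) n 0)) n e z α x' * (((n : ℝ) ^ 4 / 2) * faceWt (ctrOff 4 n) n α x'))) (vertexOfK (coDressKBmAt (ctr 4 n) n (KInvStep (d := 3) n 0)) n (JsB12CombSh0 hodd N (symTablesAn1S2 3 n cΛ) cΛ (-((n : ℝ) ^ 12 / 4)) 0).S a 0) - comp (vertexOfK (coDressKBmAt (ctr 4 n) n (KInvStep (d := 3) n 0)) n (JsB12CombSh0 hodd N (symTablesAn1S2 3 n cΛ) cΛ (-((n : ℝ) ^ 12 / 4)) 0).S a 0) (diagK fun x b => -(∑ α : Fin (3 + 1), ∑ x' ∈ blockSitesF n (blk n (legSite (ctr 4 n) x b)), colH (coDressKBmAt (ctr 4 n) n (KInvStep (d := 3) n 0)) n e z α x' * (((n : ℝ) ^ 4 / 2) * faceWt (ctrOff 4 n) n α x'))))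
              + (comp (diagK fun x b => -(∑ α : Fin (3 + 1), ∑ x' ∈ blockSitesF n (blk n (legSite (ctr 4 n) x b)), colH (coDressKBmAt (ctr 4 n) n (KInvStep (d := 3) n 0)) n a 0 α x' * (((n : ℝ) ^ 4 / 2) * faceWt (ctrOff 4 n) n α x'))) (vertexOfK (coDressKBmAt (ctr 4 n) n (KInvStep (d := 3) n 0)) n (JsB12CombSh0 hodd N (symTablesAn1S2 3 n cΛ) cΛ (-((n : ℝ) ^ 12 / 4)) 0).S e z) - comp (vertexOfK (coDressKBmAt (ctr 4 n) n (KInvStep (d := 3) n 0)) n (JsB12CombSh0 hodd N (symTablesAn1S2 3 n cΛ) cΛ (-((n : ℝ) ^ 12 / 4)) 0).S e z) (diagK fun x b => -(∑ α : Fin (3 + 1), ∑ x' ∈ blockSitesF n (blk n (legSite (ctr 4 n) x b)), colH (coDressKBmAt (ctr 4 n) n (KInvStep (d := 3) n 0)) n a 0 α x' * (((n : ℝ) ^ 4 / 2) * faceWt (ctrOff 4 n) n α x')))))))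
      ((|cΛ| / 2) * (S * (2 * GT * ((4 * ((MG163 4 * periodConst (kappa163 4) 3) * (1 + 8 * (1 + Real.exp (kappa163 4 / 4))) * Real.exp (kappa163 4 / 4))
            * (1 + 16 / (kappa163 4 / 4)) ^ 4) * ((((n : ℝ) ^ 5)⁻¹ * (4 * ((3 : ℝ) ^ (3 + 1) * ((3 + 1 : ℕ) : ℝ) * (16 * ((3 + 1 : ℕ) : ℝ)) * (MG163 4 * periodConst (kappa163 4) 3)
              * Real.exp (kappa163 4 / 4) * Real.exp (kappa163 4 / 4) * Real.exp (kappa163 4 / 4))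
            * Real.exp (kappa163 4 / 4 / 2) * Zl 4 (kappa163 4 / 4 / 8)) * (2 * (ell (3 + 1) n : ℝ) ^ 2 * Real.exp (σ * (4 * ((((3 : ℕ) : ℝ) + 1) * (n : ℝ)))))) * Real.exp (kappa163 4 / 4 / 2)))
          + 2 * GT * ((4 * ((MG163 4 * periodConst (kappa163 4) 3) * (1 + 8 * (1 + Real.exp (kappa163 4 / 4))) * Real.exp (kappa163 4 / 4))
            * (1 + 16 / (kappa163 4 / 4)) ^ 4) * ((((n : ℝ) ^ 5)⁻¹ * (4 * ((3 : ℝ) ^ (3 + 1) * ((3 + 1 : ℕ) : ℝ) * (16 * ((3 + 1 : ℕ) : ℝ)) * (MG163 4 * periodConst (kappa163 4) 3)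
              * Real.exp (kappa163 4 / 4) * Real.exp (kappa163 4 / 4) * Real.exp (kappa163 4 / 4))
            * Real.exp (kappa163 4 / 4 / 2) * Zl 4 (kappa163 4 / 4 / 8)) * (2 * (ell (3 + 1) n : ℝ) ^ 2 * Real.exp (σ * (4 * ((((3 : ℕ) : ℝ) + 1) * (n : ℝ)))))) * Real.exp (kappa163 4 / 4 / 2)))))) ((n : ℝ) * σ) := by
  have hn1 : 1 ≤ n := Nat.one_le_iff_ne_zero.2 (NeZero.ne n)
  have hσr : σ ≤ kappa163 4 / 4 / (4 * ((n : ℕ) : ℝ)) := by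
    refine hσ16.trans ?_
    have hκ := kappa163_pos 4
    have hn0 : (0 : ℝ) < n := by exact_mod_cast hn1
    rw [div_le_div_iff_of_pos_left (by positivity) (by positivity) (by positivity)]
    nlinarith
  exact decay510_row_lamf_mass_of_env n hodd hGT0 hg N cΛ hG hS hσ hσr (fun ν y' => wmass_VLam_record n hσ.le hσ16 ν y') a e

/-- **ROW (lamf) IN (5.10)-DECAY CURRENCY, MODULO `Bdd G₀ S` ONLY** [our objects + folklore] (`n` odd, `3 ≤ n`; `0 < σ ≤ κ′∕(16n)`): for every `(a, e)`,
`Decay510 (z ↦ ½·tadpole G₀ (W^{Λ}_f a 0 e z)) ((|cΛ|∕2)·(S·(2·GΛ(n)·MV(n) + 2·GΛ(n)·MV(n)))) (n·σ)`, `MV(n) = (4·C_{G₀}′·(1+16∕κ′)⁴)·mT_Λ(n)` — `decay510_row_lamf_record_of_env` at TT31 §1's split envelope `GΛ(n)`.  The shape of `ChartDefectHead.abs_secondMoment_chartDefect_le_of_decay510_rows`' `hDlamf` (pin `hWlamf := fun _ _ _ ↦ rfl`). -/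
theorem decay510_row_lamf_record (hodd : Odd n) (hn3 : 3 ≤ n) (N : ℕ) (cΛ : ℝ) {S : ℝ} (hG : Bdd (coDressKBmAt (ctr 4 n) n (KInvStep (d := 3) n 0)) S) (hS : 0 ≤ S)
    {σ : ℝ} (hσ : 0 < σ) (hσ16 : σ ≤ kappa163 4 / 4 / (16 * ((n : ℕ) : ℝ))) (a e : Fin (3 + 1)) :
    Decay510 (fun z : Site 4 => (1 / 2 : ℝ) * tadpole (coDressKBmAt (ctr 4 n) n (KInvStep (d := 3) n 0))
        (((comp (diagK fun x b => -(∑ α : Fin (3 + 1), ∑ x' ∈ blockSitesF n (blk n (legSite (ctr 4 n) x b)), colH (coDressKBmAt (ctr 4 n) n (KInvStep (d := 3) n 0)) n e z α x' * (((n : ℝ) ^ 4 / 2) * faceWt (ctrOff 4 n) n α x'))) (vertexOfK (coDressKBmAt (ctr 4 n) n (KInvStep (d := 3) n 0)) n (fun κ u => ((n : ℝ) ^ 4) • wilsonA 3 κ u + (-((n : ℝ) ^ 8 / 2)) • symVhSAt (ctr 4 n) 3 n rfl κ u) a 0) - comp (vertexOfK (coDressKBmAt (ctr 4 n) n (KInvStep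 (d := 3) n 0)) n (fun κ u => ((n : ℝ) ^ 4) • wilsonA 3 κ u + (-((n : ℝ) ^ 8 / 2)) • symVhSAt (ctr 4 n) 3 n rfl κ u) a 0) (diagK fun x b => -(∑ α : Fin (3 + 1), ∑ x' ∈ blockSitesF n (blk n (legSite (ctr 4 n) x b)), colH (coDressKBmAt (ctr 4 n) n (KInvStep (d := 3) n 0)) n e z α x' * (((n : ℝ) ^ 4 / 2) * faceWt (ctrOff 4 n) n α x'))))
              + (comp (diagK fun x b => -(∑ α : Fin (3 + 1), ∑ x' ∈ blockSitesF n (blk n (legSite (ctr 4 n) x b)), colH (coDressKBmAt (ctr 4 n) n (KInvStep (d := 3) n 0)) n a 0 α x' * (((n : ℝ) ^ 4 / 2) * faceWt (ctrOff 4 n) n α x'))) (vertexOfK (coDressKBmAt (ctr 4 n) n (KInvStep (d := 3) n 0)) n (fun κ u => ((n : ℝ) ^ 4) • wilsonA 3 κ u + (-((n : ℝ) ^ 8 / 2)) • symVhSAt (ctr 4 n) 3 n rfl κ u) e z) - comp (vertexOfK (coDressKBmAt (ctr 4 n) n (KInvStep (d := 3) n 0)) n (fun κ u => ((n : ℝ)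 ^ 4) • wilsonA 3 κ u + (-((n : ℝ) ^ 8 / 2)) • symVhSAt (ctr 4 n) 3 n rfl κ u) e z) (diagK fun x b => -(∑ α : Fin (3 + 1), ∑ x' ∈ blockSitesF n (blk n (legSite (ctr 4 n) x b)), colH (coDressKBmAt (ctr 4 n) n (KInvStep (d := 3) n 0)) n a 0 α x' * (((n : ℝ) ^ 4 / 2) * faceWt (ctrOff 4 n) n α x')))))
            - ((comp (diagK fun x b => -(∑ α : Fin (3 + 1), ∑ x' ∈ blockSitesF n (blk n (legSite (ctr 4 n) x b)), colH (coDressKBmAt (ctr 4 n) n (KInvStep (d := 3) n 0)) n e z α x' * (((n : ℝ) ^ 4 / 2) * faceWt (ctrOff 4 n) n α x'))) (vertexOfK (coDressKBmAt (ctr 4 n) n (KInvStep (d := 3) n 0)) n (JsB12CombSh0 hodd N (symTablesAn1S2 3 n cΛ) cΛ (-((n : ℝ) ^ 12 / 4)) 0).S a 0) - comp (vertexOfK (coDressKBmAt (ctr 4 n) n (KInvStep (d := 3) n 0)) n (JsB12CombSh0 hodd N (symTablesAn1S2 3 n cΛ) cΛ (-((n : ℝ) ^ 12 / 4)) 0).S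 a 0) (diagK fun x b => -(∑ α : Fin (3 + 1), ∑ x' ∈ blockSitesF n (blk n (legSite (ctr 4 n) x b)), colH (coDressKBmAt (ctr 4 n) n (KInvStep (d := 3) n 0)) n e z α x' * (((n : ℝ) ^ 4 / 2) * faceWt (ctrOff 4 n) n α x'))))
              + (comp (diagK fun x b => -(∑ α : Fin (3 + 1), ∑ x' ∈ blockSitesF n (blk n (legSite (ctr 4 n) x b)), colH (coDressKBmAt (ctr 4 n) n (KInvStep (d := 3) n 0)) n a 0 α x' * (((n : ℝ) ^ 4 / 2) * faceWt (ctrOff 4 n) n α x'))) (vertexOfK (coDressKBmAt (ctr 4 n) n (KInvStep (d := 3) n 0)) n (JsB12CombSh0 hodd N (symTablesAn1S2 3 n cΛ) cΛ (-((n : ℝ) ^ 12 / 4)) 0).S e z) - comp (vertexOfK (coDressKBmAt (ctr 4 n) n (KInvStep (d := 3) n 0)) n (JsB12CombSh0 hodd N (symTablesAn1S2 3 n cΛ) cΛ (-((n : ℝ) ^ 12 / 4)) 0).S e z) (diagK fun x b => -(∑ α : Fin (3 + 1), ∑ x' ∈ blockSitesF n (blk n (legSite (ctr 4 n) x b)),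 colH (coDressKBmAt (ctr 4 n) n (KInvStep (d := 3) n 0)) n a 0 α x' * (((n : ℝ) ^ 4 / 2) * faceWt (ctrOff 4 n) n α x')))))))
      ((|cΛ| / 2) * (S * (2 * ((((((n : ℕ) : ℝ) ^ 5)⁻¹ * (8 * (MD163 4 * periodConst (kappa163 4) 3) * Real.exp (kappa163 4 / 4))) * ((n : ℝ) ^ 4 / 2 * ((((3 : ℕ) : ℝ) + 1) * ((n : ℝ) * (((3 : ℕ) : ℝ) + 1)))) + ((((n : ℕ) : ℝ) ^ 4)⁻¹ * ((MG163 4 * periodConst (kappa163 4) 3) * (1 + 8 * (1 + Real.exp (kappa163 4 / 4))) * Real.exp (kappa163 4 / 4))) * ((n : ℝ) ^ 4 / 2 * ((((box (3 + 1) n).card : ℝ))⁻¹ * (2 * ((((3 : ℕ) : ℝ)) + 1) ^ 2 * (n : ℝ) ^ (3 + 1))))) * Real.exp ((kappa163 4 / 4 / (4 * ((n : ℕ) : ℝ))) * (l1 (ctr 4 n) + ((3 + 1 : ℕ) : ℝ) * (n : ℝ)))) * ((4 * ((MG163 4 * periodConst (kappa163 4) 3) * (1 + 8 * (1 + Real.exp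 (kappa163 4 / 4))) * Real.exp (kappa163 4 / 4))
            * (1 + 16 / (kappa163 4 / 4)) ^ 4) * ((((n : ℝ) ^ 5)⁻¹ * (4 * ((3 : ℝ) ^ (3 + 1) * ((3 + 1 : ℕ) : ℝ) * (16 * ((3 + 1 : ℕ) : ℝ)) * (MG163 4 * periodConst (kappa163 4) 3)
              * Real.exp (kappa163 4 / 4) * Real.exp (kappa163 4 / 4) * Real.exp (kappa163 4 / 4))
            * Real.exp (kappa163 4 / 4 / 2) * Zl 4 (kappa163 4 / 4 / 8)) * (2 * (ell (3 + 1) n : ℝ) ^ 2 * Real.exp (σ * (4 * ((((3 : ℕ) : ℝ) + 1) * (n : ℝ)))))) * Real.exp (kappa163 4 / 4 / 2)))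
          + 2 * ((((((n : ℕ) : ℝ) ^ 5)⁻¹ * (8 * (MD163 4 * periodConst (kappa163 4) 3) * Real.exp (kappa163 4 / 4))) * ((n : ℝ) ^ 4 / 2 * ((((3 : ℕ) : ℝ) + 1) * ((n : ℝ) * (((3 : ℕ) : ℝ) + 1)))) + ((((n : ℕ) : ℝ) ^ 4)⁻¹ * ((MG163 4 * periodConst (kappa163 4) 3) * (1 + 8 * (1 + Real.exp (kappa163 4 / 4))) * Real.exp (kappa163 4 / 4))) * ((n : ℝ) ^ 4 / 2 * ((((box (3 + 1) n).card : ℝ))⁻¹ * (2 * ((((3 : ℕ) : ℝ)) + 1) ^ 2 * (n : ℝ) ^ (3 + 1))))) * Real.exp ((kappa163 4 / 4 / (4 * ((n : ℕ) : ℝ))) * (l1 (ctr 4 n) + ((3 + 1 : ℕ) : ℝ) * (n : ℝ)))) * ((4 * ((MG163 4 * periodConst (kappa163 4) 3) * (1 + 8 * (1 + Real.exp (kappa163 4 / 4))) * Real.exp (kappa163 4 / 4))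
            * (1 + 16 / (kappa163 4 / 4)) ^ 4) * ((((n : ℝ) ^ 5)⁻¹ * (4 * ((3 : ℝ) ^ (3 + 1) * ((3 + 1 : ℕ) : ℝ) * (16 * ((3 + 1 : ℕ) : ℝ)) * (MG163 4 * periodConst (kappa163 4) 3)
              * Real.exp (kappa163 4 / 4) * Real.exp (kappa163 4 / 4) * Real.exp (kappa163 4 / 4))
            * Real.exp (kappa163 4 / 4 / 2) * Zl 4 (kappa163 4 / 4 / 8)) * (2 * (ell (3 + 1) n : ℝ) ^ 2 * Real.exp (σ * (4 * ((((3 : ℕ) : ℝ) + 1) * (n : ℝ)))))) * Real.exp (kappa163 4 / 4 / 2)))))) ((n : ℝ) * σ) :=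
  decay510_row_lamf_record_of_env n hodd (faceLamGenConst_nonneg n hn3) (abs_faceLamGen_G₀_legSite_le n hn3) N cΛ hG hS hσ hσ16 a e

/-- **ROW (lamf) IN THE HEAD's BINDER SHAPES, MODULO `Bdd G₀ S` ONLY** [our objects + folklore] (`ChartDefectHead.abs_secondMoment_chartDefect_le_of_rows`' `hAlamf ∕ hBlamf`, pin
`hWlamf := fun _ _ _ ↦ rfl`; `n` odd, `3 ≤ n`; `0 < σ ≤ κ′∕(16n)`): (i) `∀ a e, AbsMoment₂ (Wlamf a e)`; (ii) `|secondMoment Wlamf μ ν| ≤ C_lamf(n)·Σ'_x |x|₁²e^{−(n·σ)|x|₁}` — `decay510_row_lamf_record` + lit `absMoment₂_of_decay510 ∕ secondMoment_abs_le_of_decay510`.  Located `C_lamf ≍ |cΛ|·S·n⁻³`; the `n`-law of `S` is NOT claimed. -/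
theorem row_lamf_mass_record (hodd : Odd n) (hn3 : 3 ≤ n) (N : ℕ) (cΛ : ℝ) {S : ℝ} (hG : Bdd (coDressKBmAt (ctr 4 n) n (KInvStep (d := 3) n 0)) S) (hS : 0 ≤ S)
    {σ : ℝ} (hσ : 0 < σ) (hσ16 : σ ≤ kappa163 4 / 4 / (16 * ((n : ℕ) : ℝ))) (μ ν : Fin (3 + 1)) :
    (∀ a e : Fin (3 + 1), AbsMoment₂ (fun z : Site 4 => (1 / 2 : ℝ) * tadpole (coDressKBmAt (ctr 4 n) n (KInvStep (d := 3) n 0))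
        (((comp (diagK fun x b => -(∑ α : Fin (3 + 1), ∑ x' ∈ blockSitesF n (blk n (legSite (ctr 4 n) x b)), colH (coDressKBmAt (ctr 4 n) n (KInvStep (d := 3) n 0)) n e z α x' * (((n : ℝ) ^ 4 / 2) * faceWt (ctrOff 4 n) n α x'))) (vertexOfK (coDressKBmAt (ctr 4 n) n (KInvStep (d := 3) n 0)) n (fun κ u => ((n : ℝ) ^ 4) • wilsonA 3 κ u + (-((n : ℝ) ^ 8 / 2)) • symVhSAt (ctr 4 n) 3 n rfl κ u) a 0) - comp (vertexOfK (coDressKBmAt (ctr 4 n) n (KInvStep (d := 3) n 0)) n (fun κ u => ((n : ℝ) ^ 4) • wilsonA 3 κ u + (-((n : ℝ) ^ 8 / 2)) • symVhSAt (ctr 4 n) 3 n rfl κ u) a 0) (diagK fun x b => -(∑ α : Fin (3 + 1), ∑ x' ∈ blockSitesF n (blk n (legSite (ctr 4 n) x b)), colH (coDressKBmAt (ctr 4 n) n (KInvStep (d := 3) n 0)) n e z α x' * (((n : ℝ) ^ 4 / 2) * faceWt (ctrOff 4 n) n α x'))))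
              + (comp (diagK fun x b => -(∑ α : Fin (3 + 1), ∑ x' ∈ blockSitesF n (blk n (legSite (ctr 4 n) x b)), colH (coDressKBmAt (ctr 4 n) n (KInvStep (d := 3) n 0)) n a 0 α x' * (((n : ℝ) ^ 4 / 2) * faceWt (ctrOff 4 n) n α x'))) (vertexOfK (coDressKBmAt (ctr 4 n) n (KInvStep (d := 3) n 0)) n (fun κ u => ((n : ℝ) ^ 4) • wilsonA 3 κ u + (-((n : ℝ) ^ 8 / 2)) • symVhSAt (ctr 4 n) 3 n rfl κ u) e z) - comp (vertexOfK (coDressKBmAt (ctr 4 n) n (KInvStep (d := 3) n 0)) n (fun κ u => ((n : ℝ) ^ 4) • wilsonA 3 κ u + (-((n : ℝ) ^ 8 / 2)) • symVhSAt (ctr 4 n) 3 n rfl κ u) e z) (diagK fun x b => -(∑ α : Fin (3 + 1), ∑ x' ∈ blockSitesF n (blk n (legSite (ctr 4 n) x b)), colH (coDressKBmAt (ctr 4 n) n (KInvStep (d := 3) n 0)) n a 0 α x' * (((n : ℝ) ^ 4 / 2) * faceWt (ctrOff 4 n) n α x')))))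
            - ((comp (diagK fun x b => -(∑ α : Fin (3 + 1), ∑ x' ∈ blockSitesF n (blk n (legSite (ctr 4 n) x b)), colH (coDressKBmAt (ctr 4 n) n (KInvStep (d := 3) n 0)) n e z α x' * (((n : ℝ) ^ 4 / 2) * faceWt (ctrOff 4 n) n α x'))) (vertexOfK (coDressKBmAt (ctr 4 n) n (KInvStep (d := 3) n 0)) n (JsB12CombSh0 hodd N (symTablesAn1S2 3 n cΛ) cΛ (-((n : ℝ) ^ 12 / 4)) 0).S a 0) - comp (vertexOfK (coDressKBmAt (ctr 4 n) n (KInvStep (d := 3) n 0)) n (JsB12CombSh0 hodd N (symTablesAn1S2 3 n cΛ) cΛ (-((n : ℝ) ^ 12 / 4)) 0).S a 0) (diagK fun x b => -(∑ α : Fin (3 + 1), ∑ x' ∈ blockSitesF n (blk n (legSite (ctr 4 n) x b)), colH (coDressKBmAt (ctr 4 n) n (KInvStep (d := 3) n 0)) n e z α x' * (((n : ℝ) ^ 4 / 2) * faceWt (ctrOff 4 n) n α x'))))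
              + (comp (diagK fun x b => -(∑ α : Fin (3 + 1), ∑ x' ∈ blockSitesF n (blk n (legSite (ctr 4 n) x b)), colH (coDressKBmAt (ctr 4 n) n (KInvStep (d := 3) n 0)) n a 0 α x' * (((n : ℝ) ^ 4 / 2) * faceWt (ctrOff 4 n) n α x'))) (vertexOfK (coDressKBmAt (ctr 4 n) n (KInvStep (d := 3) n 0)) n (JsB12CombSh0 hodd N (symTablesAn1S2 3 n cΛ) cΛ (-((n : ℝ) ^ 12 / 4)) 0).S e z) - comp (vertexOfK (coDressKBmAt (ctr 4 n) n (KInvStep (d := 3) n 0)) n (JsB12CombSh0 hodd N (symTablesAn1S2 3 n cΛ) cΛ (-((n : ℝ) ^ 12 / 4)) 0).S e z) (diagK fun x b => -(∑ α : Fin (3 + 1), ∑ x' ∈ blockSitesF n (blk n (legSite (ctr 4 n) x b)), colH (coDressKBmAt (ctr 4 n) n (KInvStep (d := 3) n 0)) n a 0 α x' * (((n : ℝ) ^ 4 / 2) * faceWt (ctrOff 4 n) n α x')))))))) ∧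
      |B12Beta.secondMoment (fun (a e : Fin (3 + 1)) (z : Site 4) => (1 / 2 : ℝ) * tadpole (coDressKBmAt (ctr 4 n) n (KInvStep (d := 3) n 0))
        (((comp (diagK fun x b => -(∑ α : Fin (3 + 1), ∑ x' ∈ blockSitesF n (blk n (legSite (ctr 4 n) x b)), colH (coDressKBmAt (ctr 4 n) n (KInvStep (d := 3) n 0)) n e z α x' * (((n : ℝ) ^ 4 / 2) * faceWt (ctrOff 4 n) n α x'))) (vertexOfK (coDressKBmAt (ctr 4 n) n (KInvStep (d := 3) n 0)) n (fun κ u => ((n : ℝ) ^ 4) • wilsonA 3 κ u + (-((n : ℝ) ^ 8 / 2)) • symVhSAt (ctr 4 n) 3 n rfl κ u) a 0) - comp (vertexOfK (coDressKBmAt (ctr 4 n) n (KInvStep (d := 3) n 0)) n (fun κ u => ((n : ℝ) ^ 4) • wilsonA 3 κ u + (-((n : ℝ) ^ 8 / 2)) • symVhSAt (ctr 4 n) 3 n rfl κ u) a 0) (diagK fun x b => -(∑ α : Fin (3 + 1), ∑ x' ∈ blockSitesF n (blk n (legSite (ctr 4 n) x b)), colH (coDressKBmAt (ctr 4 n) n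 (KInvStep (d := 3) n 0)) n e z α x' * (((n : ℝ) ^ 4 / 2) * faceWt (ctrOff 4 n) n α x'))))
              + (comp (diagK fun x b => -(∑ α : Fin (3 + 1), ∑ x' ∈ blockSitesF n (blk n (legSite (ctr 4 n) x b)), colH (coDressKBmAt (ctr 4 n) n (KInvStep (d := 3) n 0)) n a 0 α x' * (((n : ℝ) ^ 4 / 2) * faceWt (ctrOff 4 n) n α x'))) (vertexOfK (coDressKBmAt (ctr 4 n) n (KInvStep (d := 3) n 0)) n (fun κ u => ((n : ℝ) ^ 4) • wilsonA 3 κ u + (-((n : ℝ) ^ 8 / 2)) • symVhSAt (ctr 4 n) 3 n rfl κ u) e z) - comp (vertexOfK (coDressKBmAt (ctr 4 n) n (KInvStep (d := 3) n 0)) n (fun κ u => ((n : ℝ) ^ 4) • wilsonA 3 κ u + (-((n : ℝ) ^ 8 / 2)) • symVhSAt (ctr 4 n) 3 n rfl κ u) e z) (diagK fun x b => -(∑ α : Fin (3 + 1), ∑ x' ∈ blockSitesF n (blk n (legSite (ctr 4 n) x b)), colH (coDressKBmAt (ctr 4 n) n (KInvStep (d := 3) n 0)) n a 0 α x' * (((n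 : ℝ) ^ 4 / 2) * faceWt (ctrOff 4 n) n α x')))))
            - ((comp (diagK fun x b => -(∑ α : Fin (3 + 1), ∑ x' ∈ blockSitesF n (blk n (legSite (ctr 4 n) x b)), colH (coDressKBmAt (ctr 4 n) n (KInvStep (d := 3) n 0)) n e z α x' * (((n : ℝ) ^ 4 / 2) * faceWt (ctrOff 4 n) n α x'))) (vertexOfK (coDressKBmAt (ctr 4 n) n (KInvStep (d := 3) n 0)) n (JsB12CombSh0 hodd N (symTablesAn1S2 3 n cΛ) cΛ (-((n : ℝ) ^ 12 / 4)) 0).S a 0) - comp (vertexOfK (coDressKBmAt (ctr 4 n) n (KInvStep (d := 3) n 0)) n (JsB12CombSh0 hodd N (symTablesAn1S2 3 n cΛ) cΛ (-((n : ℝ) ^ 12 / 4)) 0).S a 0) (diagK fun x b => -(∑ α : Fin (3 + 1), ∑ x' ∈ blockSitesF n (blk n (legSite (ctr 4 n) x b)), colH (coDressKBmAt (ctr 4 n) n (KInvStep (d := 3) n 0)) n e z α x' * (((n : ℝ) ^ 4 / 2) * faceWt (ctrOff 4 n) n α x'))))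
              + (comp (diagK fun x b => -(∑ α : Fin (3 + 1), ∑ x' ∈ blockSitesF n (blk n (legSite (ctr 4 n) x b)), colH (coDressKBmAt (ctr 4 n) n (KInvStep (d := 3) n 0)) n a 0 α x' * (((n : ℝ) ^ 4 / 2) * faceWt (ctrOff 4 n) n α x'))) (vertexOfK (coDressKBmAt (ctr 4 n) n (KInvStep (d := 3) n 0)) n (JsB12CombSh0 hodd N (symTablesAn1S2 3 n cΛ) cΛ (-((n : ℝ) ^ 12 / 4)) 0).S e z) - comp (vertexOfK (coDressKBmAt (ctr 4 n) n (KInvStep (d := 3) n 0)) n (JsB12CombSh0 hodd N (symTablesAn1S2 3 n cΛ) cΛ (-((n : ℝ) ^ 12 / 4)) 0).S e z) (diagK fun x b => -(∑ α : Fin (3 + 1), ∑ x' ∈ blockSitesF n (blk n (legSite (ctr 4 n) x b)), colH (coDressKBmAt (ctr 4 n) n (KInvStep (d := 3) n 0)) n a 0 α x' * (((n : ℝ) ^ 4 / 2) * faceWt (ctrOff 4 n) n α x'))))))) μ ν|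
        ≤ ((|cΛ| / 2) * (S * (2 * ((((((n : ℕ) : ℝ) ^ 5)⁻¹ * (8 * (MD163 4 * periodConst (kappa163 4) 3) * Real.exp (kappa163 4 / 4))) * ((n : ℝ) ^ 4 / 2 * ((((3 : ℕ) : ℝ) + 1) * ((n : ℝ) * (((3 : ℕ) : ℝ) + 1)))) + ((((n : ℕ) : ℝ) ^ 4)⁻¹ * ((MG163 4 * periodConst (kappa163 4) 3) * (1 + 8 * (1 + Real.exp (kappa163 4 / 4))) * Real.exp (kappa163 4 / 4))) * ((n : ℝ) ^ 4 / 2 * ((((box (3 + 1) n).card : ℝ))⁻¹ * (2 * ((((3 : ℕ) : ℝ)) + 1) ^ 2 * (n : ℝ) ^ (3 + 1))))) * Real.exp ((kappa163 4 / 4 / (4 * ((n : ℕ) : ℝ))) * (l1 (ctr 4 n) + ((3 + 1 : ℕ) : ℝ) * (n : ℝ)))) * ((4 * ((MG163 4 * periodConst (kappa163 4) 3) * (1 + 8 * (1 + Real.exp (kappa163 4 / 4))) * Real.exp (kappa163 4 / 4))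
            * (1 + 16 / (kappa163 4 / 4)) ^ 4) * ((((n : ℝ) ^ 5)⁻¹ * (4 * ((3 : ℝ) ^ (3 + 1) * ((3 + 1 : ℕ) : ℝ) * (16 * ((3 + 1 : ℕ) : ℝ)) * (MG163 4 * periodConst (kappa163 4) 3)
              * Real.exp (kappa163 4 / 4) * Real.exp (kappa163 4 / 4) * Real.exp (kappa163 4 / 4))
            * Real.exp (kappa163 4 / 4 / 2) * Zl 4 (kappa163 4 / 4 / 8)) * (2 * (ell (3 + 1) n : ℝ) ^ 2 * Real.exp (σ * (4 * ((((3 : ℕ) : ℝ) + 1) * (n : ℝ)))))) * Real.exp (kappa163 4 / 4 / 2)))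
          + 2 * ((((((n : ℕ) : ℝ) ^ 5)⁻¹ * (8 * (MD163 4 * periodConst (kappa163 4) 3) * Real.exp (kappa163 4 / 4))) * ((n : ℝ) ^ 4 / 2 * ((((3 : ℕ) : ℝ) + 1) * ((n : ℝ) * (((3 : ℕ) : ℝ) + 1)))) + ((((n : ℕ) : ℝ) ^ 4)⁻¹ * ((MG163 4 * periodConst (kappa163 4) 3) * (1 + 8 * (1 + Real.exp (kappa163 4 / 4))) * Real.exp (kappa163 4 / 4))) * ((n : ℝ) ^ 4 / 2 * ((((box (3 + 1) n).card : ℝ))⁻¹ * (2 * ((((3 : ℕ) : ℝ)) + 1) ^ 2 * (n : ℝ) ^ (3 + 1))))) * Real.exp ((kappa163 4 / 4 / (4 * ((n : ℕ) : ℝ))) * (l1 (ctr 4 n) + ((3 + 1 : ℕ) : ℝ) * (n : ℝ)))) * ((4 * ((MG163 4 * periodConst (kappa163 4) 3) * (1 + 8 * (1 + Real.exp (kappa163 4 / 4))) * Real.exp (kappa163 4 / 4))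
            * (1 + 16 / (kappa163 4 / 4)) ^ 4) * ((((n : ℝ) ^ 5)⁻¹ * (4 * ((3 : ℝ) ^ (3 + 1) * ((3 + 1 : ℕ) : ℝ) * (16 * ((3 + 1 : ℕ) : ℝ)) * (MG163 4 * periodConst (kappa163 4) 3)
              * Real.exp (kappa163 4 / 4) * Real.exp (kappa163 4 / 4) * Real.exp (kappa163 4 / 4))
            * Real.exp (kappa163 4 / 4 / 2) * Zl 4 (kappa163 4 / 4 / 8)) * (2 * (ell (3 + 1) n : ℝ) ^ 2 * Real.exp (σ * (4 * ((((3 : ℕ) : ℝ) + 1) * (n : ℝ)))))) * Real.exp (kappa163 4 / 4 / 2))))))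
          * ∑' x : Site 4, l1 x ^ 2 * Real.exp (-((n : ℝ) * σ) * l1 x) := by
  have hn1 : 1 ≤ n := le_trans (by norm_num) hn3
  have hrate : 0 < (n : ℝ) * σ := mul_pos (by exact_mod_cast hn1) hσ
  have hd := fun a e => decay510_row_lamf_record n hodd hn3 N cΛ hG hS hσ hσ16 a e
  refine ⟨fun a e => absMoment₂_of_decay510 hrate (hd a e), ?_⟩
  exact (secondMoment_abs_le_of_decay510 (P := fun (a e : Fin (3 + 1)) (z : Site 4) => (1 / 2 : ℝ) * tadpole (coDressKBmAt (ctr 4 n) n (KInvStep (d := 3) n 0))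
        (((comp (diagK fun x b => -(∑ α : Fin (3 + 1), ∑ x' ∈ blockSitesF n (blk n (legSite (ctr 4 n) x b)), colH (coDressKBmAt (ctr 4 n) n (KInvStep (d := 3) n 0)) n e z α x' * (((n : ℝ) ^ 4 / 2) * faceWt (ctrOff 4 n) n α x'))) (vertexOfK (coDressKBmAt (ctr 4 n) n (KInvStep (d := 3) n 0)) n (fun κ u => ((n : ℝ) ^ 4) • wilsonA 3 κ u + (-((n : ℝ) ^ 8 / 2)) • symVhSAt (ctr 4 n) 3 n rfl κ u) a 0) - comp (vertexOfK (coDressKBmAt (ctr 4 n) n (KInvStep (d := 3) n 0)) n (fun κ u => ((n : ℝ) ^ 4) • wilsonA 3 κ u + (-((n : ℝ) ^ 8 / 2)) • symVhSAt (ctr 4 n) 3 n rfl κ u) a 0) (diagK fun x b => -(∑ α : Fin (3 + 1), ∑ x' ∈ blockSitesF n (blk n (legSite (ctr 4 n) x b)), colH (coDressKBmAt (ctr 4 n) n (KInvStep (d := 3) n 0)) n e z α x' * (((n : ℝ) ^ 4 / 2) * faceWt (ctrOff 4 n) n α x'))))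
              + (comp (diagK fun x b => -(∑ α : Fin (3 + 1), ∑ x' ∈ blockSitesF n (blk n (legSite (ctr 4 n) x b)), colH (coDressKBmAt (ctr 4 n) n (KInvStep (d := 3) n 0)) n a 0 α x' * (((n : ℝ) ^ 4 / 2) * faceWt (ctrOff 4 n) n α x'))) (vertexOfK (coDressKBmAt (ctr 4 n) n (KInvStep (d := 3) n 0)) n (fun κ u => ((n : ℝ) ^ 4) • wilsonA 3 κ u + (-((n : ℝ) ^ 8 / 2)) • symVhSAt (ctr 4 n) 3 n rfl κ u) e z) - comp (vertexOfK (coDressKBmAt (ctr 4 n) n (KInvStep (d := 3) n 0)) n (fun κ u => ((n : ℝ) ^ 4) • wilsonA 3 κ u + (-((n : ℝ) ^ 8 / 2)) • symVhSAt (ctr 4 n) 3 n rfl κ u) e z) (diagK fun x b => -(∑ α : Fin (3 + 1), ∑ x' ∈ blockSitesF n (blk n (legSite (ctr 4 n) x b)), colH (coDressKBmAt (ctr 4 n) n (KInvStep (d := 3) n 0)) n a 0 α x' * (((n : ℝ) ^ 4 / 2) * faceWt (ctrOff 4 n) n α x')))))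
            - ((comp (diagK fun x b => -(∑ α : Fin (3 + 1), ∑ x' ∈ blockSitesF n (blk n (legSite (ctr 4 n) x b)), colH (coDressKBmAt (ctr 4 n) n (KInvStep (d := 3) n 0)) n e z α x' * (((n : ℝ) ^ 4 / 2) * faceWt (ctrOff 4 n) n α x'))) (vertexOfK (coDressKBmAt (ctr 4 n) n (KInvStep (d := 3) n 0)) n (JsB12CombSh0 hodd N (symTablesAn1S2 3 n cΛ) cΛ (-((n : ℝ) ^ 12 / 4)) 0).S a 0) - comp (vertexOfK (coDressKBmAt (ctr 4 n) n (KInvStep (d := 3) n 0)) n (JsB12CombSh0 hodd N (symTablesAn1S2 3 n cΛ) cΛ (-((n : ℝ) ^ 12 / 4)) 0).S a 0) (diagK fun x b => -(∑ α : Fin (3 + 1), ∑ x' ∈ blockSitesF n (blk n (legSite (ctr 4 n) x b)), colH (coDressKBmAt (ctr 4 n) n (KInvStep (d := 3) n 0)) n e z α x' * (((n : ℝ) ^ 4 / 2) * faceWt (ctrOff 4 n) n α x'))))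
              + (comp (diagK fun x b => -(∑ α : Fin (3 + 1), ∑ x' ∈ blockSitesF n (blk n (legSite (ctr 4 n) x b)), colH (coDressKBmAt (ctr 4 n) n (KInvStep (d := 3) n 0)) n a 0 α x' * (((n : ℝ) ^ 4 / 2) * faceWt (ctrOff 4 n) n α x'))) (vertexOfK (coDressKBmAt (ctr 4 n) n (KInvStep (d := 3) n 0)) n (JsB12CombSh0 hodd N (symTablesAn1S2 3 n cΛ) cΛ (-((n : ℝ) ^ 12 / 4)) 0).S e z) - comp (vertexOfK (coDressKBmAt (ctr 4 n) n (KInvStep (d := 3) n 0)) n (JsB12CombSh0 hodd N (symTablesAn1S2 3 n cΛ) cΛ (-((n : ℝ) ^ 12 / 4)) 0).S e z) (diagK fun x b => -(∑ α : Fin (3 + 1), ∑ x' ∈ blockSitesF n (blk n (legSite (ctr 4 n) x b)), colH (coDressKBmAt (ctr 4 n) n (KInvStep (d := 3) n 0)) n a 0 α x' * (((n : ℝ) ^ 4 / 2) * faceWt (ctrOff 4 n) n α x'))))))) hrate (hd μ ν)).2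

end Record

end Summit.QuantumFields.BalabanUV.Beta.D1BFx.ChartDefectRowLamfClosed

end
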